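import Literature.IUT.HodgeTheaters.GlobalFrobenioidsWhiskerBNatEndRigidity
import Literature.IUT.HodgeTheaters.Cor53iFcircHkerTransport
import HarnessLib

/-!
# [IUTchI] Cor 5.3 (i) «resp. `⊚`» at the record carrier `†ℱ^⊚ → †𝒟^⊚`: the Ex 5.1 (v) binder `hB⊚` (𝔹-RATIO⊚) DISCHARGED along
# every GALOIS-RICH base morphism — `hker⊚` and the injectivity of `Aut(†ℱ^⊚) → Aut(†𝒟^⊚)` with NO ratio hypothesis

S. Mochizuki, *Inter-universal Teichmüller theory I*, kurims manuscript (May 2020), §5 Cor 5.3 (i) p. 144 l. 2–11 («resp.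
`†ℱ^⊚`»), proof l. 24–33; Ex 5.1 (iii) pp. 125–126 (`†ℱ^⊚ := †ℱ^⊛|_{†𝒟^⊚}`), (v) pp. 127–128 ([IUTchI] Cor 5.3 (i) p.144; Ex 5.1 (v)
p.128) [claim: Mochizuki2012, status: disputed] (D-0012 claim key; this file PROVES statements about the cell's typed carriers;
nothing of the series is asserted; no side taken on [IUTchIII] Cor. 3.12).  [FrdI]: S. Mochizuki, *The geometry of Frobenioids I*,
Kyushu J. Math. **62** (2008), Prop 1.6 p. 27, Cor 4.10 p. 90, Thm 5.2 (ii) p. 101, Ex 6.3 p. 113 [cite: MochizukiFrdI2008, Prop. 1.6 p.27].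

PROOF-ONLY KNIT (cell abc-iut, seat abc-iut-L5-t11 gen 17, row «HBCIRC-PUSH» file (⊚-2), abc-iut-L5-lead gen 10 RULINGS #173 (3) /
#179; 0 def / 0 instance / 0 notation / no Prop fact).  STATE OF RECORD: ★ `Cor53iFcircHkerTransport` gives `hker⊚ :=
RigidOverBase 𝓕.fcircBase` for every isomorph `†ℱ^⊛` of `ℱ^⊛(†𝒟^⊚)` over `†𝒟^⊚ = ℬ(H)⁰` (`H` slim) from the ONE binder `hB⊚` —
the unit-ratio law for the model of the whiskered data `(Φ^⊛ ∘ T, 𝔹 ∘ T, Div ∘ T)`, `T := 𝓕.baseMor ⋙ 𝓕.identify`.  AS TYPED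
(every `toBase0`) `hB⊚` is refutable at a constant base morphism (abc-iut-L5-t16, «HB⊚-DEGENERATE-CARRIER»).  REPAIRED BINDER
(OURS, on OUR carrier, booked RULINGS #173 (3)): `hS` — the whiskering `T ⋙ galoisSubextOfFinite F : ℬ(H)⁰ → FinSubextCat F F̄`
is ISOMORPHIC to a GALOIS-RICH one (★ `GlobalFrobenioidsWhiskerBNatEndRigidity`: (G1) cover, (G2) directed by inclusions, (G3)
Galois arrows over the field `K₀` of a base object `c₀`), which is the shape of the INTENDED `†𝒟^⊚ → †𝒟^⊛` of [IUTchI] Ex 5.1 (i)/(iii)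
(induction along the open injection `π₁(C_K) ↪ π₁(C_{F_mod})`; in the tree `CosetCat.push ι`, instance NOT proved here).
* **`Cor53.whisker_ratioRigid_of_iso_galoisRich (S) (hZ) (hS)`** — `hB⊚` in the `S`-whiskered currency, a THEOREM under `hS`
  (the record form `S := (𝓕.baseMor ⋙ 𝓕.identify) ⋙ galoisSubextOfFinite F` is consumed by the one-liner below): the categorical
  half ★ `Cor53.whisker_exists_unitsAut_of_overBase` ([FrdI] Cor 4.10 / Thm 5.2 (ii), hypothesis-free) gives ONE natural
  automorphism `ᾱ` of `𝔹 ∘ T` with the ratio clause; ★ `whisker_unitsFamily_apply_eq_self_of_iso_galoisRich` (gluing +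
  abc-iut-L5-t16's Kummer/class-group rigidity over `K₀`) kills it;
* **`Cor53.fcirc_rigidOverBase_of_galoisRich 𝓕 (hZ) (hS) : CatIsomorphism.RigidOverBase 𝓕.fcircBase`** — `hker⊚` with NO ratio
  hypothesis; **`Cor53.fcirc_descend_injective_of_galoisRich`** — `Aut(†ℱ^⊚) → Aut(†𝒟^⊚)` injective;
  `Cor53.fcirc_descendBijective_of_galoisRich_of_lifts (hlift)` — Cor 5.3 (i) «resp. `⊚`» AS PRINTED modulo the surjectivity input
  `hlift⊚` alone (abc-iut-L5-t4's ★ `Cor53TelescopeCensusKnit` chain, BY NAME).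
CENSUS of the `⊚`-slot after this file: injectivity ⟸ {`H` slim, `hS`} · LAW ∅ · FACT ∅; bijectivity additionally ⟸ {`hlift⊚`}.
HONEST TAGS: `hS` is displayed, not discharged (the `CosetCat.push ι` instance is a separate row); typed ≠ inhabited ≠ proved;
nothing here asserts abc proved or refuted.
-/

noncomputable section

set_option backward.isDefEq.respectTransparency false

namespace Literature.IUT.HodgeTheaters

open CategoryTheory Opposite Literature.AlgebraicGeometry.Frobenioids Literature.AnabelianGeometry.SemiGraphs
open Literature.AlgebraicGeometry.Frobenioids.QuasiTemperoid

namespace Cor53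

section Fcirc

variable {F : Type} [Field F] [NumberField F] {H : ProfiniteGrp.{0}} {toBase0 : BaseCat H ⥤ BaseCat (absGalGrp F)}
  (𝓕 : GlobalFrobenioid (GlobalDivisorData.arith F) (BaseCat H) toBase0)

/-- **`hB⊚` (𝔹-RATIO at the `⊚`-slot) IS A THEOREM along a Galois-rich whiskering**: for `H` slim and
`S : ℬ(H)⁰ → FinSubextCat F F̄` isomorphic to a Galois-rich `S′` (binder `hS`: (G1) cover, (G2) directed by inclusions, (G3) Galois
arrows over `K₀ := (S′ c₀).L`), every self-equivalence `Ψ` of the model of the whiskered data `(Φ^⊛ ∘ S, 𝔹 ∘ S, Div ∘ S)` over the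
identity of `ℬ(H)⁰` preserves through any `η` the rational function of every pair of parallel linear arrows — the unit-ratio law
((a) ★ `whisker_exists_unitsAut_of_overBase` + (b) ★ `whisker_unitsFamily_apply_eq_self_of_iso_galoisRich`).  Stated in the
`S`-whiskered currency; the record form is the one-liner below. ([IUTchI] Cor 5.3 (i) p.144; Ex 5.1 (v) p.128)
[cite: MochizukiFrdI2008, Thm. 5.2 (ii) p.101] [claim: Mochizuki2012, status: disputed] -/
theorem whisker_ratioRigid_of_iso_galoisRich (S : BaseCat H ⥤ FinSubextCat F (Fbar F)) (hZ : IsSlimGroup H)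
    (hS : ∃ (S' : BaseCat H ⥤ FinSubextCat F (Fbar F)) (c₀ : BaseCat H) (_ : S ≅ S'),
      (∀ u : Fbar F, ∃ c : BaseCat H, u ∈ (S'.obj c).L) ∧
      (∀ c₁ c₂ : BaseCat H, ∃ (c₃ : BaseCat H) (g₁ : c₃ ⟶ c₁) (g₂ : c₃ ⟶ c₂),
        (∀ y : (S'.obj c₁).L, (((S'.map g₁).toAlgHom y : (S'.obj c₃).L) : Fbar F) = y) ∧
        (∀ y : (S'.obj c₂).L, (((S'.map g₂).toAlgHom y : (S'.obj c₃).L) : Fbar F) = y)) ∧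
      (∀ (σ : Fbar F ≃ₐ[(S'.obj c₀).L] Fbar F) (u : Fbar F), ∃ (c c' : BaseCat H) (g : c' ⟶ c),
        u ∈ (S'.obj c).L ∧ ∀ y : (S'.obj c).L, (((S'.map g).toAlgHom y : (S'.obj c').L) : Fbar F) = σ y)) :
    ∀ Ψ : (GlobalDivisorData.mk (S.op ⋙ arithDivisorFunctor F (Fbar F)) (S.op ⋙ unitsFunctor F (Fbar F))
        (Functor.whiskerLeft S.op (divNatTrans F (Fbar F))) : GlobalDivisorData H).ModelGlobalFrobenioid ≌
      (GlobalDivisorData.mk (S.op ⋙ arithDivisorFunctor F (Fbar F)) (S.op ⋙ unitsFunctor F (Fbar F))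
        (Functor.whiskerLeft S.op (divNatTrans F (Fbar F))) : GlobalDivisorData H).ModelGlobalFrobenioid,
      Nonempty (Ψ.functor ⋙ (GlobalDivisorData.mk (S.op ⋙ arithDivisorFunctor F (Fbar F)) (S.op ⋙ unitsFunctor F (Fbar F))
        (Functor.whiskerLeft S.op (divNatTrans F (Fbar F))) : GlobalDivisorData H).modelBase ≅
        (GlobalDivisorData.mk (S.op ⋙ arithDivisorFunctor F (Fbar F)) (S.op ⋙ unitsFunctor F (Fbar F))
        (Functor.whiskerLeft S.op (divNatTrans F (Fbar F))) : GlobalDivisorData H).modelBase) →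
      ∃ η : Ψ.functor ⋙ (GlobalDivisorData.mk (S.op ⋙ arithDivisorFunctor F (Fbar F)) (S.op ⋙ unitsFunctor F (Fbar F))
        (Functor.whiskerLeft S.op (divNatTrans F (Fbar F))) : GlobalDivisorData H).modelBase ≅
        (GlobalDivisorData.mk (S.op ⋙ arithDivisorFunctor F (Fbar F)) (S.op ⋙ unitsFunctor F (Fbar F))
        (Functor.whiskerLeft S.op (divNatTrans F (Fbar F))) : GlobalDivisorData H).modelBase,
        ∀ ⦃X Y : (GlobalDivisorData.mk (S.op ⋙ arithDivisorFunctor F (Fbar F)) (S.op ⋙ unitsFunctor F (Fbar F))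
        (Functor.whiskerLeft S.op (divNatTrans F (Fbar F))) : GlobalDivisorData H).ModelGlobalFrobenioid⦄ (f g : X ⟶ Y),
          ModelFrobenioid.degFr f = 1 → ModelFrobenioid.degFr g = 1 → ModelFrobenioid.baseMap f = ModelFrobenioid.baseMap g →
            ModelFrobenioid.unit (Ψ.functor.map f) *
                pull (S.op ⋙ unitsFunctor F (Fbar F)) (A := X.base) (B := (Ψ.functor.obj X).base) (η.hom.app X)
                  (ModelFrobenioid.unit g) =
              ModelFrobenioid.unit (Ψ.functor.map g) *
                pull (S.op ⋙ unitsFunctor F (Fbar F)) (A := X.base) (B := (Ψ.functor.obj X).base) (η.hom.app X)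
                  (ModelFrobenioid.unit f) := by
  obtain ⟨S', c₀, φ, hcov, hdir, hgal⟩ := hS
  rintro Ψ ⟨η⟩
  obtain ⟨ᾱ, hnat, hdiv, hratio⟩ := Cor53.whisker_exists_unitsAut_of_overBase F S hZ Ψ η
  obtain ⟨ε, hε⟩ := hdiv c₀
  have h1 : ∀ (A : BaseCat H) (w : (S.op ⋙ unitsFunctor F (Fbar F)).obj (op A)), ᾱ A w = w := fun A w =>
    GlobalDivisorData.whisker_unitsFamily_apply_eq_self_of_iso_galoisRich F S S' φ c₀ hcov hdir hgal ᾱ hnat ε hε A w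
  refine ⟨η, fun X Y f g hf hg hfg => ?_⟩
  have h := hratio f g hf hg hfg
  rw [h1, h1] at h
  exact h

/-- **[IUTchI] Cor 5.3 (i) «resp. `⊚`», injectivity content at the record carrier — `hker⊚ = RigidOverBase 𝓕.fcircBase` with NO
ratio hypothesis**, for `H` slim and a Galois-rich base morphism (`hS`): every self-equivalence of `†ℱ^⊚` lying over the identity of
`†𝒟^⊚` is isomorphic to the identity (`hB⊚` DISCHARGED into ★ `Cor53.fcirc_rigidOverBase_of_ratioRigid`).
([IUTchI] Cor 5.3 (i) p.144) [cite: MochizukiFrdI2008, Prop. 1.6 p.27] [claim: Mochizuki2012, status: disputed] -/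
theorem fcirc_rigidOverBase_of_galoisRich (hZ : IsSlimGroup H)
    (hS : ∃ (S' : BaseCat H ⥤ FinSubextCat F (Fbar F)) (c₀ : BaseCat H)
      (_ : ((𝓕.baseMor ⋙ 𝓕.identify.functor) ⋙ galoisSubextOfFinite F) ≅ S'),
      (∀ u : Fbar F, ∃ c : BaseCat H, u ∈ (S'.obj c).L) ∧
      (∀ c₁ c₂ : BaseCat H, ∃ (c₃ : BaseCat H) (g₁ : c₃ ⟶ c₁) (g₂ : c₃ ⟶ c₂),
        (∀ y : (S'.obj c₁).L, (((S'.map g₁).toAlgHom y : (S'.obj c₃).L) : Fbar F) = y) ∧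
        (∀ y : (S'.obj c₂).L, (((S'.map g₂).toAlgHom y : (S'.obj c₃).L) : Fbar F) = y)) ∧
      (∀ (σ : Fbar F ≃ₐ[(S'.obj c₀).L] Fbar F) (u : Fbar F), ∃ (c c' : BaseCat H) (g : c' ⟶ c),
        u ∈ (S'.obj c).L ∧ ∀ y : (S'.obj c).L, (((S'.map g).toAlgHom y : (S'.obj c').L) : Fbar F) = σ y)) :
    CatIsomorphism.RigidOverBase 𝓕.fcircBase :=
  fcirc_rigidOverBase_of_ratioRigid 𝓕 hZ
    (whisker_ratioRigid_of_iso_galoisRich ((𝓕.baseMor ⋙ 𝓕.identify.functor) ⋙ galoisSubextOfFinite F) hZ hS)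

/-- **[IUTchI] Cor 5.3 (i) «resp. `⊚`»: the natural map `Aut(†ℱ^⊚) → Aut(†𝒟^⊚)` is INJECTIVE** for `H` slim and a Galois-rich base
morphism — the §0 map `CatIsomorphism.descend` at the record carrier (its existence/uniqueness binders discharged by ★
`GlobalFrobenioid.hasUnder_and_underUnique_fcircBase_arith_baseCat`), through abc-iut-L5-t4's ★
`fcirc_descend_injective_of_kernel_trivial`. ([IUTchI] Cor 5.3 (i) p.144) [cite: MochizukiFrdI2008, Prop. 1.6 p.27]
[claim: Mochizuki2012, status: disputed] -/
theorem fcirc_descend_injective_of_galoisRich (hZ : IsSlimGroup H)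
    (hS : ∃ (S' : BaseCat H ⥤ FinSubextCat F (Fbar F)) (c₀ : BaseCat H)
      (_ : ((𝓕.baseMor ⋙ 𝓕.identify.functor) ⋙ galoisSubextOfFinite F) ≅ S'),
      (∀ u : Fbar F, ∃ c : BaseCat H, u ∈ (S'.obj c).L) ∧
      (∀ c₁ c₂ : BaseCat H, ∃ (c₃ : BaseCat H) (g₁ : c₃ ⟶ c₁) (g₂ : c₃ ⟶ c₂),
        (∀ y : (S'.obj c₁).L, (((S'.map g₁).toAlgHom y : (S'.obj c₃).L) : Fbar F) = y) ∧
        (∀ y : (S'.obj c₂).L, (((S'.map g₂).toAlgHom y : (S'.obj c₃).L) : Fbar F) = y)) ∧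
      (∀ (σ : Fbar F ≃ₐ[(S'.obj c₀).L] Fbar F) (u : Fbar F), ∃ (c c' : BaseCat H) (g : c' ⟶ c),
        u ∈ (S'.obj c).L ∧ ∀ y : (S'.obj c).L, (((S'.map g).toAlgHom y : (S'.obj c').L) : Fbar F) = σ y)) :
    Function.Injective (CatIsomorphism.descend
      (GlobalFrobenioid.hasUnder_and_underUnique_fcircBase_arith_baseCat 𝓕 𝓕 hZ hZ).1
      (GlobalFrobenioid.hasUnder_and_underUnique_fcircBase_arith_baseCat 𝓕 𝓕 hZ hZ).2) :=
  fcirc_descend_injective_of_kernel_trivial 𝓕 hZ (fcirc_rigidOverBase_of_galoisRich 𝓕 hZ hS)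

/-- **[IUTchI] Cor 5.3 (i) «resp. `⊚`» AS PRINTED («bijective») at the record carrier modulo the surjectivity input `hlift⊚`
ALONE**, for `H` slim and a Galois-rich base morphism (abc-iut-L5-t4's ★ `fcirc_descendBijective_of_kernel_trivial_of_lifts`).
([IUTchI] Cor 5.3 (i) p.144) [cite: MochizukiFrdI2008, Prop. 1.6 p.27] [claim: Mochizuki2012, status: disputed] -/
theorem fcirc_descendBijective_of_galoisRich_of_lifts (hZ : IsSlimGroup H)
    (hS : ∃ (S' : BaseCat H ⥤ FinSubextCat F (Fbar F)) (c₀ : BaseCat H)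
      (_ : ((𝓕.baseMor ⋙ 𝓕.identify.functor) ⋙ galoisSubextOfFinite F) ≅ S'),
      (∀ u : Fbar F, ∃ c : BaseCat H, u ∈ (S'.obj c).L) ∧
      (∀ c₁ c₂ : BaseCat H, ∃ (c₃ : BaseCat H) (g₁ : c₃ ⟶ c₁) (g₂ : c₃ ⟶ c₂),
        (∀ y : (S'.obj c₁).L, (((S'.map g₁).toAlgHom y : (S'.obj c₃).L) : Fbar F) = y) ∧
        (∀ y : (S'.obj c₂).L, (((S'.map g₂).toAlgHom y : (S'.obj c₃).L) : Fbar F) = y)) ∧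
      (∀ (σ : Fbar F ≃ₐ[(S'.obj c₀).L] Fbar F) (u : Fbar F), ∃ (c c' : BaseCat H) (g : c' ⟶ c),
        u ∈ (S'.obj c).L ∧ ∀ y : (S'.obj c).L, (((S'.map g).toAlgHom y : (S'.obj c').L) : Fbar F) = σ y))
    (hlift : ∀ Θ : BaseCat H ≌ BaseCat H, ∃ Ψ : 𝓕.Fcirc ≌ 𝓕.Fcirc,
      Nonempty (CatIsomorphism.LiesUnder 𝓕.fcircBase 𝓕.fcircBase Ψ Θ)) :
    CatIsomorphism.DescendBijective 𝓕.fcircBase 𝓕.fcircBase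
      (GlobalFrobenioid.hasUnder_and_underUnique_fcircBase_arith_baseCat 𝓕 𝓕 hZ hZ).1
      (GlobalFrobenioid.hasUnder_and_underUnique_fcircBase_arith_baseCat 𝓕 𝓕 hZ hZ).2 :=
  fcirc_descendBijective_of_kernel_trivial_of_lifts 𝓕 hZ (fcirc_rigidOverBase_of_galoisRich 𝓕 hZ hS) hlift

end Fcirc

end Cor53

end Literature.IUT.HodgeTheaters

end
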